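import Mathlib
import HarnessLib

/-!
# `NoHeavyLowerTail` (crux stmt-CriticalPhenomena-4575), antithetic vdBHK programme: the KLEITMAN SANDWICH (tool T17)

Support file (seat `prim-ineq-gen-7` gen 28; `--supports stmt-CriticalPhenomena-4575`).  No `sorry`, no definitions, nothing asserted about
the crux.  Memo: run/shared/lean/prim/prim-ineq-gen-7/FINDING-LEVEL-g28.md (THEOREM L: the abstract per-level inequality LEVEL(r) of
FINDING-PHI-g27 §4c holds for ALL r; its proof is a pointwise finite lemma plus nonnegative multiples of the sandwich below).

For an upper family `U` and a lower family `D` of subsets of a finite type (`σ` = complement map, `Uᶜˢ = σ(U)`):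

* `AntitheticSandwich.card_inter_le_card_compls_inter` — `#(U ∩ D) ≤ #(Uᶜˢ ∩ D)`;
* `AntitheticSandwich.card_inter_le_card_inter_compls` — `#(U ∩ D) ≤ #(U ∩ Dᶜˢ)`.

Proof: Harris–Kleitman twice — `2^n · #(U ∩ D) ≤ #U · #D` (an upper and a lower family anticorrelate) and, since `Uᶜˢ` is a lower
family with `#Uᶜˢ = #U`, `#Uᶜˢ · #D ≤ 2^n · #(Uᶜˢ ∩ D)` (two lower families correlate).  The shadow lemma of gen 27
(`AntitheticShadow.card_le_card_infs_inter_compls_sups`) is the case `U = ↑𝒟`, `D = ↓𝒟`.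
-/

namespace Summit.CriticalPhenomena.PercolationContinuityZ3.Theorems

open Finset
open scoped FinsetFamily

namespace AntitheticSandwich

variable {β : Type*} [DecidableEq β] [Fintype β]

/-- The complement image `Uᶜˢ` of an upper family `U` is a lower family. [this work] -/
theorem isLowerSet_compls (U : Finset (Finset β)) (hU : IsUpperSet (U : Set (Finset β))) :
    IsLowerSet ((Uᶜˢ : Finset (Finset β)) : Set (Finset β)) := by
  intro x y hyx hx
  rw [Finset.mem_coe, Finset.mem_compls] at hx ⊢
  exact hU (compl_le_compl hyx) hx

/-- The complement image `Dᶜˢ` of a lower family `D` is an upper family. [this work] -/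
theorem isUpperSet_compls (D : Finset (Finset β)) (hD : IsLowerSet (D : Set (Finset β))) :
    IsUpperSet ((Dᶜˢ : Finset (Finset β)) : Set (Finset β)) := by
  intro x y hxy hx
  rw [Finset.mem_coe, Finset.mem_compls] at hx ⊢
  exact hD (compl_le_compl hxy) hx

/-- **KLEITMAN SANDWICH (first form).**  For an upper family `U` and a lower family `D` of subsets of a finite type,
`#(U ∩ D) ≤ #(Uᶜˢ ∩ D)`: the antipodal image of `U` meets `D` at least as often as `U` does.
[this work; Harris–Kleitman `IsUpperSet.card_inter_le_finset` + `IsLowerSet.le_card_inter_finset`] -/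
theorem card_inter_le_card_compls_inter (U D : Finset (Finset β)) (hU : IsUpperSet (U : Set (Finset β)))
    (hD : IsLowerSet (D : Set (Finset β))) : #(U ∩ D) ≤ #(Uᶜˢ ∩ D) := by
  have h1 := hU.card_inter_le_finset hD
  -- h1 : 2 ^ Fintype.card β * #(U ∩ D) ≤ #U * #D
  have h2 := (isLowerSet_compls U hU).le_card_inter_finset hD
  rw [Finset.card_compls] at h2
  -- h2 : #U * #D ≤ 2 ^ Fintype.card β * #(Uᶜˢ ∩ D)
  exact Nat.le_of_mul_le_mul_left (h1.trans h2) (by positivity)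

/-- **KLEITMAN SANDWICH (second form).**  For an upper family `U` and a lower family `D` of subsets of a finite type,
`#(U ∩ D) ≤ #(U ∩ Dᶜˢ)`. [this work; Harris–Kleitman `IsUpperSet.card_inter_le_finset` + `IsUpperSet.le_card_inter_finset`] -/
theorem card_inter_le_card_inter_compls (U D : Finset (Finset β)) (hU : IsUpperSet (U : Set (Finset β)))
    (hD : IsLowerSet (D : Set (Finset β))) : #(U ∩ D) ≤ #(U ∩ Dᶜˢ) := by
  have h1 := hU.card_inter_le_finset hD
  have h2 := hU.le_card_inter_finset (isUpperSet_compls D hD)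
  rw [Finset.card_compls] at h2
  exact Nat.le_of_mul_le_mul_left (h1.trans h2) (by positivity)

omit [Fintype β] in
/-- Intersections of upper families are upper families (bookkeeping for the certificate dictionaries, whose `U` are intersections of
up to three core families). [this work] -/
theorem isUpperSet_inter (U V : Finset (Finset β)) (hU : IsUpperSet (U : Set (Finset β))) (hV : IsUpperSet (V : Set (Finset β))) :
    IsUpperSet ((U ∩ V : Finset (Finset β)) : Set (Finset β)) := by
  rw [Finset.coe_inter]; exact hU.inter hV

omit [Fintype β] in
/-- Intersections of lower families are lower families. [this work] -/
theorem isLowerSet_inter (D E : Finset (Finset β)) (hD : IsLowerSet (D : Set (Finset β))) (hE : IsLowerSet (E : Set (Finset β))) :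
    IsLowerSet ((D ∩ E : Finset (Finset β)) : Set (Finset β)) := by
  rw [Finset.coe_inter]; exact hD.inter hE

end AntitheticSandwich

end Summit.CriticalPhenomena.PercolationContinuityZ3.Theorems
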